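import Summits.NavierStokesRegularity.NavierStokesRegularity.Theses.TypeILiouville
import Literature.Analysis.FluidPDE.ClassicalShortTimeSupBound
import HarnessLib

/-!
# The Type-I rate propagates from a parabolically dense set of times
# (crux `TypeIliouvilleNoTypeII`, stmt-NavierStokesRegularity-0056 — a first rung on the Type-II side)

The hard core `NoTypeII` (`Theses.TypeILiouville.TypeIliouvilleNoTypeII`, shared residual of the
routes ScaledTopAlignment / L3TimeExponentPincer / the door family) asks that a maximal classical
Leray–Hopf solution from a rapidly decaying datum blows up at the self-similar rate
`‖u(t)‖_∞ ≤ C/√(T − t)` for ALL `t` near `T`.  This file proves, from Leray's doubling time for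
finite-energy classical solutions (tree theorem
`Literature.Analysis.FluidPDE.exists_norm_le_two_mul_of_finiteEnergy_from`; Leray 1934 §21 (3.15),
Ożański–Pooley 2018 Lemma 6.23 (i)), that it is enough to know the rate on a PARABOLICALLY DENSE set
of times:

* `rate_propagates` — if `‖u(t₀, ·)‖ ≤ C/√(T − t₀)` at ONE time `t₀ < T`, then
  `‖u(t, ·)‖ ≤ 2C/√(T − t)` on the forward window `t − t₀ < c₀ ν (T − t₀)/C²`, whose length is a
  FIXED FRACTION `c₀ν/C²` of the time to blow-up (`c₀` Leray's universal constant);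
* `isTypeIBlowup_of_rate_on_covering_set` — if the rate-`C` bound holds on a set `G ⊆ [0, T)` of
  times whose forward windows eventually cover a left neighbourhood of `T`, then `IsTypeIBlowup u T`
  (constant `2C`);
* `isTypeIBlowup_of_rate_on_sequence` — the rate at the terms of ONE sequence `t_k → T` with gaps
  `t_{k+1} − t_k < c₀ν(T − t_k)/C²` suffices; `isTypeIBlowup_of_rate_on_geometric_sequence` — in
  particular at the geometric checkpoints `T − h₀θᵏ`, `1 − θ < c₀ν/C²`;
* `isTypeIBlowup_of_rate_off_thin_set` — MOST-TIMES ⇒ ALL-TIMES for the rate: if the bound fails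
  only on a set `B` of times of final upper density `< c₀ν/C²` at `T`
  (`|B ∩ (T − h, T)| ≤ (c₀ν/C²)·h` is violated for no small `h`), then `IsTypeIBlowup u T`;
* `typeIliouvilleNoTypeII_of_rateOffNullDensitySet` — hence the crux `TypeIliouvilleNoTypeII`
  follows BY NAME from the a-priori estimate «every maximal classical Leray–Hopf solution from a
  rapidly decaying datum obeys the rate-`C` bound, some `C`, off a time set of final density zero».

Read contrapositively: at a Type-II blow-up, for every level `C` the bad times
`{t : √(T − t)‖u(t)‖_∞ > C}` have final upper density at least `c₀ν/C²` — Type-II episodes are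
parabolically macroscopic in time, at every level.  Nothing here excludes blow-up; the statements
reduce the sup-rate conclusion of the crux to a sparser one (a Type-II-exclusion criterion in the
class «rate off a thin time set»), outside the regime where Navier–Stokes regularity is known
(a Type-I blow-up is not excluded by anything in the tree: hard core stmt-1217).

References: Leray 1934, Acta Math. 63, §19 (3.8), §21 (3.14)–(3.16); Ożański–Pooley 2018,
Lemma 6.23 (i), Cor. 6.24 (i) (tree file `ClassicalShortTimeSupBound.lean`).
-/

noncomputable section

-- the summit and its single problem share the name `NavierStokesRegularity` (D-0017 nested layout)
set_option linter.dupNamespace false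

open Set Function Filter Topology MeasureTheory Metric
open scoped NNReal ENNReal

namespace Summit.NavierStokesRegularity.NavierStokesRegularity.Theorems.TypeIliouvilleNoTypeII.RateCovering

open Literature.Analysis Literature.Analysis.FluidPDE

/-! ## Finite energy on closed sub-slabs -/

/-- An unforced Leray–Hopf solution (`ν ≥ 0`) has `∫ ‖u(t)‖² ≤ ∫ ‖u(0)‖²` at EVERY time
`t ∈ [0, T']`, `T' ≤ T`, in the extended form consumed by
`exists_norm_le_two_mul_of_finiteEnergy_from` (energy inequality from `s = 0`, dissipation
dropped; every slice is `L²`). [cite: Leray1934, (5.2)] -/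
theorem finiteEnergy_of_lerayHopf {ν T T' : ℝ} (hν : 0 ≤ ν) {u : ℝ → (EuclideanSpace ℝ (Fin 3)) → (EuclideanSpace ℝ (Fin 3))}
    (hLH : IsLerayHopfOn T ν 0 (u 0) u) (hT' : T' ≤ T) :
    ∃ C : ℝ≥0∞, C < ⊤ ∧ ∀ t ∈ Icc 0 T', ∫⁻ x, ‖u t x‖ₑ ^ 2 ≤ C := by
  refine ⟨ENNReal.ofReal (2 * VectorCalculus.kineticEnergy (u 0)), ENNReal.ofReal_lt_top, ?_⟩
  intro t ht
  have htT : t ∈ Icc 0 T := ⟨ht.1, ht.2.trans hT'⟩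
  obtain ⟨G, -, hE⟩ := hLH.energy_ineq_zero
  have h := hE t htT
  simp only [Pi.zero_apply, inner_zero_left, integral_zero, intervalIntegral.integral_zero,
    add_zero] at h
  have hd : 0 ≤ ν * (∫⁻ τ in Ioo 0 t, ∫⁻ x, ENNReal.ofReal (frobeniusNormSq (G τ x))).toReal :=
    mul_nonneg hν ENNReal.toReal_nonneg
  have hkin : VectorCalculus.kineticEnergy (u t) ≤ VectorCalculus.kineticEnergy (u 0) := by
    linarith
  have heq : ∫⁻ x, ‖u t x‖ₑ ^ 2 = eEnergy (u t) := rfl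
  rw [heq, hLH.eEnergy_eq htT]
  exact ENNReal.ofReal_le_ofReal (by linarith)

/-! ## One-time propagation of the rate -/

/-- **The Type-I rate propagates forward for a fixed fraction of the remaining time.**  With
Leray's universal doubling constant `c₀ > 0`: if `(u, p)` is a classical solution of unforced
Navier–Stokes (`ν > 0`) on `ℝ³ × [0, T)`, Leray–Hopf from `u(0)`, and
`‖u(t₀, x)‖ ≤ C/√(T − t₀)` for all `x` at some `t₀ ∈ [0, T)` (`C > 0`), then
`‖u(t, x)‖ ≤ 2C/√(T − t)` for every `t ∈ [t₀, T)` with `t − t₀ < c₀ ν (T − t₀)/C²` and every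
`x`.  Proof: Leray's doubling bound from the datum `u(t₀)` with `A = C/√(T − t₀)` on the closed
slab `[0, (t + T)/2]`, where `c₀ν/A² = c₀ν(T − t₀)/C²`, and `2A ≤ 2C/√(T − t)` as `T − t ≤ T − t₀`.
[cite: Leray1934, §21 (3.15) p. 226] -/
theorem rate_propagates :
    ∃ c₀ : ℝ, 0 < c₀ ∧ ∀ {ν T C t₀ : ℝ} {u : ℝ → (EuclideanSpace ℝ (Fin 3)) → (EuclideanSpace ℝ (Fin 3))} {p : ℝ → (EuclideanSpace ℝ (Fin 3)) → ℝ},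
      0 < ν → 0 < T → IsClassicalNSSolutionOn (Ico 0 T) ν 0 u p → IsLerayHopfOn T ν 0 (u 0) u →
      0 < C → 0 ≤ t₀ → t₀ < T → (∀ x, ‖u t₀ x‖ ≤ C / Real.sqrt (T - t₀)) →
      ∀ t ∈ Ico t₀ T, t - t₀ < c₀ * ν * (T - t₀) / C ^ 2 →
        ∀ x, ‖u t x‖ ≤ 2 * C / Real.sqrt (T - t) := by
  obtain ⟨c₀, hc₀, h⟩ := exists_norm_le_two_mul_of_finiteEnergy_from
  refine ⟨c₀, hc₀, ?_⟩
  intro ν T C t₀ u p hν hT hcl hLH hC ht₀ ht₀T hrate t ht htw x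
  -- the closed slab `[0, T']`, `T' = (t + T)/2`
  set T' : ℝ := (t + T) / 2 with hT'_def
  have htT' : t < T' := by rw [hT'_def]; linarith [ht.2]
  have hT'T : T' < T := by rw [hT'_def]; linarith [ht.2]
  have ht₀T' : t₀ < T' := lt_of_le_of_lt ht.1 htT'
  have hcl' : IsClassicalNSSolutionOn (Icc 0 T') ν 0 u p :=
    hcl.mono (Icc_subset_Ico_right hT'T) (uniqueDiffOn_Icc (by linarith))
  have hfe := finiteEnergy_of_lerayHopf hν.le hLH hT'T.le
  -- the level `A = C/√(T − t₀)`
  have hTt₀ : 0 < T - t₀ := sub_pos.2 ht₀T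
  have hTt : 0 < T - t := sub_pos.2 ht.2
  have hs₀ : 0 < Real.sqrt (T - t₀) := Real.sqrt_pos.2 hTt₀
  have hs : 0 < Real.sqrt (T - t) := Real.sqrt_pos.2 hTt
  set A : ℝ := C / Real.sqrt (T - t₀) with hA_def
  have hA : 0 < A := div_pos hC hs₀
  have hA2 : A ^ 2 = C ^ 2 / (T - t₀) := by
    rw [hA_def, div_pow, Real.sq_sqrt hTt₀.le]
  have htw' : t - t₀ < c₀ * ν / A ^ 2 := by
    rw [hA2, div_div_eq_mul_div]
    exact htw
  have key := h hν ht₀ ht₀T' hcl' hfe hA hrate t ⟨ht.1, htT'.le⟩ htw' x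
  -- `2A ≤ 2C/√(T − t)`
  have hsqrt : Real.sqrt (T - t) ≤ Real.sqrt (T - t₀) :=
    Real.sqrt_le_sqrt (by linarith [ht.1])
  calc ‖u t x‖ ≤ 2 * A := key
    _ = 2 * C / Real.sqrt (T - t₀) := by rw [hA_def, mul_div_assoc]
    _ ≤ 2 * C / Real.sqrt (T - t) :=
        div_le_div_of_nonneg_left (by positivity) hs hsqrt

/-! ## Covering criteria -/

/-- **Sequential / covering Type-I criterion.**  With Leray's constant `c₀`: let `(u, p)` be a
classical solution of unforced Navier–Stokes on `ℝ³ × [0, T)`, Leray–Hopf from `u(0)`, and let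
`G ⊆ [0, T)` be a set of times at which `‖u(s, ·)‖ ≤ C/√(T − s)` (`C > 0`).  If eventually every
`t < T` lies in the forward doubling window of some `s ∈ G` (`s ≤ t`, `t − s < c₀ν(T − s)/C²`),
then the blow-up (if any) at `T` is of Type I, with constant `2C`. [cite: Leray1934, §21 (3.15)] -/
theorem isTypeIBlowup_of_rate_on_covering_set :
    ∃ c₀ : ℝ, 0 < c₀ ∧ ∀ {ν T C : ℝ} {u : ℝ → (EuclideanSpace ℝ (Fin 3)) → (EuclideanSpace ℝ (Fin 3))} {p : ℝ → (EuclideanSpace ℝ (Fin 3)) → ℝ} {G : Set ℝ},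
      0 < ν → 0 < T → IsClassicalNSSolutionOn (Ico 0 T) ν 0 u p → IsLerayHopfOn T ν 0 (u 0) u →
      0 < C → G ⊆ Ico 0 T → (∀ s ∈ G, ∀ x, ‖u s x‖ ≤ C / Real.sqrt (T - s)) →
      (∀ᶠ t in 𝓝[<] T, ∃ s ∈ G, s ≤ t ∧ t - s < c₀ * ν * (T - s) / C ^ 2) →
      IsTypeIBlowup u T := by
  obtain ⟨c₀, hc₀, h⟩ := rate_propagates
  refine ⟨c₀, hc₀, ?_⟩
  intro ν T C u p G hν hT hcl hLH hC hG hrate hcov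
  refine ⟨2 * C, ?_⟩
  have hlt : ∀ᶠ t in 𝓝[<] T, t < T := eventually_nhdsWithin_of_forall fun t ht => ht
  filter_upwards [hcov, hlt] with t ⟨s, hsG, hst, hts⟩ htT x
  exact h hν hT hcl hLH hC (hG hsG).1 (hG hsG).2 (hrate s hsG) t ⟨hst, htT⟩ hts x

/-- **The rate along one sequence of times suffices.**  With Leray's constant `c₀`: if
`t : ℕ → ℝ` is a monotone sequence in `[0, T)` tending to `T` with parabolically small gaps
`t (k+1) − t k < c₀ν(T − t k)/C²`, and `‖u(t k, ·)‖ ≤ C/√(T − t k)` for every `k`, then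
`IsTypeIBlowup u T`. [cite: Leray1934, §21 (3.15)–(3.16)] -/
theorem isTypeIBlowup_of_rate_on_sequence :
    ∃ c₀ : ℝ, 0 < c₀ ∧ ∀ {ν T C : ℝ} {u : ℝ → (EuclideanSpace ℝ (Fin 3)) → (EuclideanSpace ℝ (Fin 3))} {p : ℝ → (EuclideanSpace ℝ (Fin 3)) → ℝ} {t : ℕ → ℝ},
      0 < ν → 0 < T → IsClassicalNSSolutionOn (Ico 0 T) ν 0 u p → IsLerayHopfOn T ν 0 (u 0) u →
      0 < C → (∀ k, t k ∈ Ico 0 T) → Monotone t → Tendsto t atTop (𝓝 T) →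
      (∀ k, t (k + 1) - t k < c₀ * ν * (T - t k) / C ^ 2) →
      (∀ k x, ‖u (t k) x‖ ≤ C / Real.sqrt (T - t k)) →
      IsTypeIBlowup u T := by
  obtain ⟨c₀, hc₀, h⟩ := isTypeIBlowup_of_rate_on_covering_set
  refine ⟨c₀, hc₀, ?_⟩
  intro ν T C u p t hν hT hcl hLH hC htI hmono hlim hgap hrate
  refine h (G := range t) hν hT hcl hLH hC (by rintro _ ⟨k, rfl⟩; exact htI k)
    (by rintro _ ⟨k, rfl⟩ x; exact hrate k x) ?_
  -- every `s ∈ [t 0, T)` lies in the window of the last `t k ≤ s`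
  have hmem : Ico (t 0) T ∈ 𝓝[<] T := Ico_mem_nhdsLT (htI 0).2
  filter_upwards [hmem] with s hs
  -- some index exceeds `s` (the sequence tends to `T > s`)
  have hex : ∃ k, s < t k := by
    have hev : ∀ᶠ k in atTop, s < t k := hlim.eventually (eventually_gt_nhds hs.2)
    exact hev.exists
  classical
  -- the first such index is positive; its predecessor is the last `t k ≤ s`
  let k₀ := Nat.find hex
  have hk₀ : s < t k₀ := Nat.find_spec hex
  have hk₀pos : 0 < k₀ := by
    by_contra h0
    have h00 : k₀ = 0 := by omega
    rw [h00] at hk₀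
    exact absurd hs.1 (not_le.2 hk₀)
  obtain ⟨k, hk⟩ : ∃ k, k₀ = k + 1 := ⟨k₀ - 1, by omega⟩
  have hks : t k ≤ s := by
    have hmin := Nat.find_min hex (show k < k₀ by omega)
    exact not_lt.1 hmin
  refine ⟨t k, ⟨k, rfl⟩, hks, ?_⟩
  rw [hk] at hk₀
  linarith [hgap k]

/-- **Geometric checkpoints suffice.**  With Leray's constant `c₀`: if for some `h₀ ∈ (0, T]`
and a ratio `θ ∈ (0, 1)` with `1 − θ < c₀ν/C²` the rate bound `‖u(T − h₀θᵏ, ·)‖ ≤ C/√(h₀θᵏ)`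
holds at every checkpoint `T − h₀θᵏ`, `k : ℕ`, then `IsTypeIBlowup u T`.  (The form in which a
certified computation or an a-priori estimate at DISCRETE times would be used.) [cite: Leray1934, §21 (3.15)–(3.16)] -/
theorem isTypeIBlowup_of_rate_on_geometric_sequence :
    ∃ c₀ : ℝ, 0 < c₀ ∧ ∀ {ν T C h₀ θ : ℝ} {u : ℝ → (EuclideanSpace ℝ (Fin 3)) → (EuclideanSpace ℝ (Fin 3))} {p : ℝ → (EuclideanSpace ℝ (Fin 3)) → ℝ},
      0 < ν → 0 < T → IsClassicalNSSolutionOn (Ico 0 T) ν 0 u p → IsLerayHopfOn T ν 0 (u 0) u →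
      0 < C → 0 < h₀ → h₀ ≤ T → 0 < θ → θ < 1 → 1 - θ < c₀ * ν / C ^ 2 →
      (∀ k : ℕ, ∀ x, ‖u (T - h₀ * θ ^ k) x‖ ≤ C / Real.sqrt (h₀ * θ ^ k)) →
      IsTypeIBlowup u T := by
  obtain ⟨c₀, hc₀, h⟩ := isTypeIBlowup_of_rate_on_sequence
  refine ⟨c₀, hc₀, ?_⟩
  intro ν T C h₀ θ u p hν hT hcl hLH hC hh₀ hh₀T hθ hθ1 hgap hrate
  have hpow : ∀ k : ℕ, 0 < h₀ * θ ^ k := fun k => mul_pos hh₀ (pow_pos hθ k)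
  have hpow1 : ∀ k : ℕ, h₀ * θ ^ k ≤ h₀ := fun k =>
    mul_le_of_le_one_right hh₀.le (pow_le_one₀ hθ.le hθ1.le)
  refine h (t := fun k => T - h₀ * θ ^ k) hν hT hcl hLH hC (fun k => ⟨?_, ?_⟩) ?_ ?_ ?_ ?_
  · linarith [hpow1 k]
  · linarith [hpow k]
  · -- monotone: `θ^(k+1) ≤ θ^k`
    refine monotone_nat_of_le_succ fun k => ?_
    have : h₀ * θ ^ (k + 1) ≤ h₀ * θ ^ k :=
      mul_le_mul_of_nonneg_left (pow_le_pow_of_le_one hθ.le hθ1.le (Nat.le_succ k)) hh₀.le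
    linarith
  · -- tends to `T`: `h₀ θ^k → 0`
    have h1 : Tendsto (fun k : ℕ => h₀ * θ ^ k) atTop (𝓝 (h₀ * 0)) :=
      (tendsto_pow_atTop_nhds_zero_of_lt_one hθ.le hθ1).const_mul h₀
    rw [mul_zero] at h1
    have h2 := h1.const_sub T
    simpa using h2
  · -- gaps: `(T − h₀θ^{k+1}) − (T − h₀θ^k) = (1 − θ)·(h₀θ^k) < c₀ν/C² · (h₀θ^k)`
    intro k
    have hk := hpow k
    have e1 : T - h₀ * θ ^ (k + 1) - (T - h₀ * θ ^ k) = (1 - θ) * (h₀ * θ ^ k) := by ring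
    have e2 : c₀ * ν * (T - (T - h₀ * θ ^ k)) / C ^ 2 = c₀ * ν / C ^ 2 * (h₀ * θ ^ k) := by
      ring
    rw [e1, e2]
    exact mul_lt_mul_of_pos_right hgap hk
  · intro k x
    have e : T - (T - h₀ * θ ^ k) = h₀ * θ ^ k := by ring
    rw [e]
    exact hrate k x

/-! ## Most times ⇒ all times -/

/-- **The rate off a thin set of times gives the rate everywhere.**  With Leray's constant `c₀`:
let `(u, p)` be a classical solution of unforced Navier–Stokes on `ℝ³ × [0, T)`, Leray–Hopf from
`u(0)`, `C > 0` with `c₀ν < C²`, and `B` a set of «bad» times such that `‖u(s, ·)‖ ≤ C/√(T − s)`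
at every `s ∈ [0, T) ∖ B`.  If the final upper density of `B` at `T` is below `c₀ν/C²` in the
sense that `|B ∩ (T − h, T)| < (c₀ν/C²)·h` for all small `h > 0` (outer Lebesgue measure; no
measurability needed), then `IsTypeIBlowup u T` (constant `2C`).  Proof: if some late `t` were in
no doubling window, all of `(t − λ(T − t), t]`, `λ = c₀ν/(C² − c₀ν)`, would be bad, a fraction
`λ/(1 + λ) = c₀ν/C²` of `(T − h, T)`, `h = (1 + λ)(T − t)`. [cite: Leray1934, §21 (3.15)–(3.16)] -/
theorem isTypeIBlowup_of_rate_off_thin_set :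
    ∃ c₀ : ℝ, 0 < c₀ ∧ ∀ {ν T C : ℝ} {u : ℝ → (EuclideanSpace ℝ (Fin 3)) → (EuclideanSpace ℝ (Fin 3))} {p : ℝ → (EuclideanSpace ℝ (Fin 3)) → ℝ} {B : Set ℝ},
      0 < ν → 0 < T → IsClassicalNSSolutionOn (Ico 0 T) ν 0 u p → IsLerayHopfOn T ν 0 (u 0) u →
      0 < C → c₀ * ν < C ^ 2 →
      (∀ s ∈ Ico 0 T, s ∉ B → ∀ x, ‖u s x‖ ≤ C / Real.sqrt (T - s)) →
      (∀ᶠ h in 𝓝[>] (0 : ℝ), volume (B ∩ Ioo (T - h) T) < ENNReal.ofReal (c₀ * ν / C ^ 2 * h)) →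
      IsTypeIBlowup u T := by
  obtain ⟨c₀, hc₀, h⟩ := isTypeIBlowup_of_rate_on_covering_set
  refine ⟨c₀, hc₀, ?_⟩
  intro ν T C u p B hν hT hcl hLH hC hcC hrate hthin
  refine h (G := Ico 0 T \ B) hν hT hcl hLH hC (fun _ hs => hs.1)
    (fun s hs x => hrate s hs.1 hs.2 x) ?_
  -- constants
  have hC2 : 0 < C ^ 2 := by positivity
  have hden : 0 < C ^ 2 - c₀ * ν := sub_pos.2 hcC
  set lam : ℝ := c₀ * ν / (C ^ 2 - c₀ * ν) with hlam_def
  have hlam : 0 < lam := div_pos (mul_pos hc₀ hν) hden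
  have hfrac : lam / (1 + lam) = c₀ * ν / C ^ 2 := by
    rw [hlam_def]
    field_simp
    ring
  -- a threshold `h₁` below which the density bound holds
  obtain ⟨h₁, hh₁, hsmall⟩ := (nhdsGT_basis (0 : ℝ)).eventually_iff.1 hthin
  -- late times: `(1 + lam)(T − t) < h₁` and `t − lam (T − t) ≥ 0`
  have hδ : 0 < min (h₁ / (1 + lam)) (T / (1 + lam)) :=
    lt_min (div_pos hh₁ (by linarith)) (div_pos hT (by linarith))
  have hmem : Ioo (T - min (h₁ / (1 + lam)) (T / (1 + lam))) T ∈ 𝓝[<] T :=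
    Ioo_mem_nhdsLT (by linarith)
  filter_upwards [hmem] with t ht
  have htT : t < T := ht.2
  have hTt : 0 < T - t := sub_pos.2 htT
  have h1l : 0 < 1 + lam := by linarith
  have hlt1 : T - t < h₁ / (1 + lam) := by linarith [ht.1, min_le_left (h₁ / (1 + lam)) (T / (1 + lam))]
  have hlt2 : T - t < T / (1 + lam) := by linarith [ht.1, min_le_right (h₁ / (1 + lam)) (T / (1 + lam))]
  have hhlt : (1 + lam) * (T - t) < h₁ := by
    have := mul_lt_mul_of_pos_left hlt1 h1l
    rwa [mul_div_cancel₀ _ h1l.ne'] at this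
  have ht0 : 0 ≤ t - lam * (T - t) := by
    have := mul_lt_mul_of_pos_left hlt2 h1l
    rw [mul_div_cancel₀ _ h1l.ne'] at this
    nlinarith
  by_contra hno
  push Not at hno
  -- every `s ∈ (t − lam (T − t), t]` is bad
  have hbad : Ioc (t - lam * (T - t)) t ⊆ B ∩ Ioo (T - (1 + lam) * (T - t)) T := by
    intro s hs
    have hs0 : 0 ≤ s := ht0.trans hs.1.le
    have hsT : s < T := lt_of_le_of_lt hs.2 htT
    refine ⟨?_, ⟨by nlinarith [hs.1], hsT⟩⟩
    by_contra hsB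
    have hwin := hno s ⟨⟨hs0, hsT⟩, hsB⟩ hs.2
    -- but `t − s < lam (T − t)` forces `t − s < c₀ν(T − s)/C²`
    have hts : t - s < lam * (T - t) := by linarith [hs.1]
    apply absurd hwin
    push Not
    -- `(t − s)(C² − c₀ν) < c₀ν(T − t)` ⇔ `t − s < c₀ν((T − t) + (t − s))/C²`
    have h3 : (t - s) * (C ^ 2 - c₀ * ν) < c₀ * ν * (T - t) := by
      have hne : C ^ 2 - c₀ * ν ≠ 0 := hden.ne'
      have h4 : lam * (T - t) * (C ^ 2 - c₀ * ν) = c₀ * ν * (T - t) := by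
        rw [hlam_def]
        field_simp
      calc (t - s) * (C ^ 2 - c₀ * ν) < lam * (T - t) * (C ^ 2 - c₀ * ν) :=
            mul_lt_mul_of_pos_right hts hden
        _ = c₀ * ν * (T - t) := h4
    rw [lt_div_iff₀ hC2]
    nlinarith
  -- measure bookkeeping: `lam (T − t) ≤ |B ∩ (T − h, T)| < (c₀ν/C²) h = lam (T − t)`
  have hmeas := measure_mono (μ := volume) hbad
  rw [Real.volume_Ioc] at hmeas
  have hpos : 0 < (1 + lam) * (T - t) := mul_pos h1l hTt
  have hd := hsmall (show (1 + lam) * (T - t) ∈ Ioo 0 h₁ from ⟨hpos, hhlt⟩)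
  have heq : c₀ * ν / C ^ 2 * ((1 + lam) * (T - t)) = t - (t - lam * (T - t)) := by
    rw [← hfrac]
    field_simp
    ring
  rw [heq] at hd
  exact absurd (lt_of_le_of_lt hmeas hd) (lt_irrefl _)

/-- **Rate off a null-density set of times ⇒ Type I** (the `C`-free special case of
`isTypeIBlowup_of_rate_off_thin_set`).  If `‖u(s, ·)‖ ≤ C/√(T − s)` off a set `B` of times of
final density ZERO at `T` (`∀ δ > 0`, eventually `|B ∩ (T − h, T)| ≤ δ h`), then
`IsTypeIBlowup u T`. [cite: Leray1934, §21 (3.15)–(3.16)] -/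
theorem isTypeIBlowup_of_rate_off_nullDensity_set {ν T C : ℝ} {u : ℝ → (EuclideanSpace ℝ (Fin 3)) → (EuclideanSpace ℝ (Fin 3))} {p : ℝ → (EuclideanSpace ℝ (Fin 3)) → ℝ}
    {B : Set ℝ} (hν : 0 < ν) (hT : 0 < T) (hcl : IsClassicalNSSolutionOn (Ico 0 T) ν 0 u p)
    (hLH : IsLerayHopfOn T ν 0 (u 0) u) (hC : 0 < C)
    (hrate : ∀ s ∈ Ico 0 T, s ∉ B → ∀ x, ‖u s x‖ ≤ C / Real.sqrt (T - s))
    (hnull : ∀ δ : ℝ, 0 < δ →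
      ∀ᶠ h in 𝓝[>] (0 : ℝ), volume (B ∩ Ioo (T - h) T) ≤ ENNReal.ofReal (δ * h)) :
    IsTypeIBlowup u T := by
  obtain ⟨c₀, hc₀, h⟩ := isTypeIBlowup_of_rate_off_thin_set
  -- enlarge `C` so that `c₀ν < C'²`: `C' = max C (√(c₀ν) + 1)`
  set C' : ℝ := max C (Real.sqrt (c₀ * ν) + 1) with hC'_def
  have hC' : 0 < C' := lt_max_of_lt_left hC
  have hcC' : c₀ * ν < C' ^ 2 := by
    have h1 : Real.sqrt (c₀ * ν) + 1 ≤ C' := le_max_right _ _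
    have h2 : 0 ≤ Real.sqrt (c₀ * ν) := Real.sqrt_nonneg _
    have h3 : Real.sqrt (c₀ * ν) ^ 2 = c₀ * ν := Real.sq_sqrt (mul_pos hc₀ hν).le
    nlinarith
  have hrate' : ∀ s ∈ Ico 0 T, s ∉ B → ∀ x, ‖u s x‖ ≤ C' / Real.sqrt (T - s) := by
    intro s hs hsB x
    have hsq : 0 < Real.sqrt (T - s) := Real.sqrt_pos.2 (sub_pos.2 hs.2)
    exact (hrate s hs hsB x).trans (div_le_div_of_nonneg_right (le_max_left _ _) hsq.le)
  refine h hν hT hcl hLH hC' hcC' hrate' ?_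
  -- density `δ = (c₀ν/C'²)/2 < c₀ν/C'²`
  have hq : 0 < c₀ * ν / C' ^ 2 := div_pos (mul_pos hc₀ hν) (by positivity)
  filter_upwards [hnull (c₀ * ν / C' ^ 2 / 2) (by positivity), self_mem_nhdsWithin] with r hr hr0
  have hr0' : (0 : ℝ) < r := hr0
  refine lt_of_le_of_lt hr (ENNReal.ofReal_lt_ofReal_iff_of_nonneg (by positivity) |>.2 ?_)
  nlinarith

/-! ## The crux from a most-times a-priori rate estimate -/

/-- **`NoTypeII` from an a-priori most-times rate estimate** (concluded BY NAME for the hard core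
`Theses.TypeILiouville.TypeIliouvilleNoTypeII`, stmt-NavierStokesRegularity-0056).  If every maximal
classical solution of unforced Navier–Stokes on `ℝ³ × [0, T)` that is Leray–Hopf from a rapidly
decaying datum obeys, for SOME constant `C`, the self-similar rate `‖u(s, ·)‖ ≤ C/√(T − s)` at all
times `s ∈ [0, T)` outside a set of final density zero at `T`, then every such blow-up is Type I.
The hypothesis is the crux weakened from ALL late times to MOST late times; the upgrade is Leray's
doubling time. [cite: Leray1934, §21 (3.15)–(3.16)] -/
theorem typeIliouvilleNoTypeII_of_rateOffNullDensitySet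
    (hmt : ∀ (ν T : ℝ), 0 < ν → 0 < T → ∀ (u : ℝ → (EuclideanSpace ℝ (Fin 3)) → (EuclideanSpace ℝ (Fin 3))) (p : ℝ → (EuclideanSpace ℝ (Fin 3)) → ℝ),
      IsMaximalSmoothSolution ν 0 u p T → IsLerayHopfOn T ν 0 (u 0) u →
      HasRapidSpatialDecay (u 0) →
      ∃ (C : ℝ) (B : Set ℝ), 0 < C ∧
        (∀ s ∈ Ico 0 T, s ∉ B → ∀ x, ‖u s x‖ ≤ C / Real.sqrt (T - s)) ∧
        (∀ δ : ℝ, 0 < δ →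
          ∀ᶠ h in 𝓝[>] (0 : ℝ), volume (B ∩ Ioo (T - h) T) ≤ ENNReal.ofReal (δ * h))) :
    Summit.NavierStokesRegularity.NavierStokesRegularity.Theses.TypeILiouville.TypeIliouvilleNoTypeII := by
  intro ν T hν hT u p hmax hLH hdec
  obtain ⟨C, B, hC, hrate, hnull⟩ := hmt ν T hν hT u p hmax hLH hdec
  exact isTypeIBlowup_of_rate_off_nullDensity_set hν hT hmax.1 hLH hC hrate hnull

end Summit.NavierStokesRegularity.NavierStokesRegularity.Theorems.TypeIliouvilleNoTypeII.RateCovering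

end
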